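import Literature.MathematicalPhysics.QuantumFieldTheory.Balaban1983to89.B9CoordSliceMajorant
import Literature.MathematicalPhysics.QuantumFieldTheory.Balaban1983to89.B9Ineq349SiteAdjoint
import Literature.MathematicalPhysics.QuantumFieldTheory.Balaban1983to89.B9RWSums343to347Whole

/-!
# `Balaban1983to89.B9Ineq349SiteFromConv342` — T. Bałaban, *Propagators for lattice gauge theories in a background field*, Commun. Math. Phys. **99**
# (1985) 389–434 [Balaban1985BackgroundPropagators], (3.49) p. 399 ⇐ Thm 3.1 (3.42) p. 397 ⇐ Thm 3.7 p. 410: ROW 25's Thm-3.1 INPUT `Left342At` ∕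
# `Thm31LeftSchema` DERIVED from the two sup block majorants of Theorem 3.7 at the N06 knit's site pins (`B9Thm37Whole.Conv342` of `GcoS`,
# `DcoS ∘ GcoS`) — (3.49) at def-Y's v4 record from what ROW 18 proves, the faithful block map, the radius-2 count and the (3.48) input only

[4] = T. Bałaban, *Propagators and renormalization transformations for lattice gauge theories. II*, Commun. Math. Phys. **96** (1984) 223–250
[`Balaban1984PropagatorsII`].

statement-level skeleton of published theorems with citation tags; proofs where landed; nothing here is a claim about the Yang–Mills mass gap

THE PRINT.  p. 399: *«These theorems [3.1, 3.2] imply all the properties of the operator R … For the operator P = I − R we obtain, using again Lemma 2.1,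
(3.49)»*; p. 410: *«Theorem 3.7 implies that all the inequalities (3.42)–(3.47) hold for G′, thus we have completed the proof of Theorem 3.1»*.

WHY THIS FILE (dag-n06-i gen 11, N06 bundle F4, row 25).  The certificate of record (n06-d `…N06AtOpsYNuOfRecordV5EPair`, p517371) displays row 25's
Thm-3.1 input as a hypothesis `h31S : Thm31SiteSchemas …` although ROW 18 already proves, inside the same certificate, `t37 : B9.Thm37Printed … E` whose
convergence predicate CONTAINS n06-c's `Conv342 (𝔬 x) 1 (H x) C δ U` — the block majorants `C(Lʲη)²e^{−δd}` of `(𝔬 x).Gp U = GcoS … (𝔏 x).Gp U` and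
`C·Lʲη·e^{−δd}` of `D U ∘ Gp U = DcoS ∘ GcoS` (pins `hblkS hblkYS hGpS hDS`).  With the sibling `B9CoordSliceMajorant` (a general test function is one
slice of the model) these majorants give `Left342At` at the non-product test functions `Q′*_U(δ_{y₁}⊗F)`; with n06-i gen 6's `B9Ineq349SiteAdjoint`
(adjoint side and symmetry of `G′(U)` are theorems at the v4 record) and `B9Ineq349SiteFromBlocks` (Lemma 2.1, power counting) ROW 25 follows from
row 18's majorants + `h32B` alone.

WHAT IS PROVED (sorry-free; no estimate of the paper).
* §1 the test functions: `QpsY_deltaY_apply` (`Q′*_U(δ_{y₁}⊗F)(z) = R(τ⁻¹)F` on `B(y₁)`, `0` elsewhere), `QpsY_deltaY_eq_zero`, `norm_QpsY_deltaY_le`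
  (`≤ 1` for contractive transporters).
* §2 ★★ `left342At_of_hasMajorants` — `HasMajorant (blkSK (sIK bI)) (GcoS …) (C·len²·e^{−δd})` and `HasMajorantHom … (DcoS ∘ GcoS) (C·len·e^{−δd})`
  (`C, δ ≥ 0`), `bI` level-∕1-faithful, `#nbr(·,2) ≤ mN`, contractive transporters ⟹ `Left342At i parS O U (mN·C·e^{2δ}) δ`.
* §3 `left342At_mono`; ★ `majorants_of_thm37Printed` (the leaf `B9.Thm37Printed c35 geo9Y bg9Y E` with `(E x).Converges U → Conv342 (𝔬 x) …` and the
  site pins ⟹ the two majorants under Theorem 3.7's printed prefix), `conv342_of_converges_E37AllOfOps` (n06-k's `E37AllOfOps`∕`E37YNbr`∕`E37YPair`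
  data converge INTO `Conv342`); at `𝔸 = M_N(ℂ)` (L²-operator norm): `norm_le_one_of_mem_unitaryUnits`, `contractive_of_mem`,
  ★★ `thm31LeftSchema_of_majorants` (`G ≤ U(N)`, transporters `G`-valued on (3.35) configurations ⟹ `Thm31LeftSchema c35 𝔏`, `B₀ = max(1, mN·C·e^{2δ})`),
  ★★★ `stmt349Printed_site_lettersYOfRecordV4_of_majorants` = ROW 25 (`B9.Stmt349Printed … (p349SiteY … (lettersYOfRecordV4 …))`) from the majorants
  under Theorem 3.7's prefix + `hlev` + `hβ1` + `hnbr` + `h32B : Thm32BlkSchema …` — the knit's `h31S` is no longer an input.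
For the knit (n06-d): `h := majorants_of_thm37Printed bK 𝔏 𝔬 E t37 hC hδ (fun x U h => h.1) hblkS hblkYS hGpS hDS` at `E x := E37YPair …` (`h.1` by
`conv342_of_converges_E37AllOfOps`), then `s349 := stmt349Printed_site_lettersYOfRecordV4_of_majorants θ M⋆ 𝔯 bK hlev hβ1 hnbr h h32B`.

HONEST SCOPE.  Finite-dimensional linear algebra and lattice bookkeeping over landed objects; the (3.48) input `h32B` of Thm 3.2 stays a displayed
hypothesis (the letter `C(U)` has no coordinate pin in the knit); the majorants themselves are what row 18 derives from its displayed walk-expansion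
schemas (`Local342`, `Identities`, sizes) — nothing of [B9] or [4] is asserted here; count-neutral; N06 NOT discharged; one finite 𝕋^{d+1} programme at
fixed ε — nothing continuum, nothing OS, nothing about the mass gap.  Cell `pub-ymgap` (HUMAN RULING D-0062), Track A node N06 [B9], seat
`pub-ymgap-dag-n06-i` (gen 11), 2026-08-27; a NEW file, nothing landed is modified.
-/

noncomputable section

namespace Literature.MathematicalPhysics.QuantumFieldTheory.Balaban1983to89.B9Ineq349SiteFromConv342

open B6RandomWalk (HasMajorant)
open B6RandomWalkHom (HasMajorantHom hasMajorantHom_iff)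
open B9CoReadingCoords (coordOpK)
open B9Thm39ReadingCoords (cR39)
open B9CoordSliceMajorant (mul_norm_apply_le_of_hasMajorantHom sum_image_sIK_le)

variable {𝔸 : Type} [NormedRing 𝔸] [NormedAlgebra ℂ 𝔸]
variable {κ : Type} [Fintype κ] [DecidableEq κ]

/-! ## §1 The test functions `Q′*_U(δ_{y₁}⊗F)` of (3.49): support and size -/

section TestFunction

open Node00 (SiteY BlkY CfgY SiteParY deltaY QpsY qpT trLiftY_apply qpsK)
open B6Geom246MultiLevelBox (blkOf)
open B6KLevelCensusIndexV1 (KIdx)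
open B9Eq39Adjoint (R R_def)

variable {d ℓ : ℕ} {hd : 1 ≤ d + 1} {hL : Odd (ℓ + 1) ∧ 1 < ℓ + 1} {b₀ b₁ : ℝ}
variable [CompleteSpace 𝔸] (i : KIdx d ℓ hd hL b₀ b₁) (parS : SiteParY 𝔸 i) (U : CfgY 𝔸 i)

/-- `Q′*_U(δ_{y₁} ⊗ F)`, evaluated: `R(τ(y₁, z)⁻¹)F` on the block `B(y₁)`, zero elsewhere ((3.19): `Q′*` transports the block value to the site).
[cite: Balaban1985BackgroundPropagators, (3.19) p.393, (3.24)–(3.25) p.395; Balaban1984PropagatorsII, (2.16) p.225] -/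
theorem QpsY_deltaY_apply (s₁ : BlkY i) (F : 𝔸) (z : SiteY i) :
    QpsY i parS U (deltaY s₁ F) z = if blkOf i.D.toDomains z = s₁ then R (qpT i parS U s₁ z)⁻¹ F else 0 := by
  rw [QpsY, trLiftY_apply, Finset.sum_eq_single s₁]
  · have hker : qpsK i z s₁ = if blkOf i.D.toDomains z = s₁ then 1 else 0 := rfl
    rw [hker]
    by_cases h : blkOf i.D.toDomains z = s₁
    · simp [deltaY, h]
    · simp [deltaY, h]
  · intro s _ hs
    simp [deltaY, hs, R_def]
  · intro h; exact absurd (Finset.mem_univ _) h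

/-- `Q′*_U(δ_{y₁} ⊗ F)` vanishes off `B(y₁)`. [cite: Balaban1985BackgroundPropagators, (3.19) p.393 («supp λ ⊂ Δ(y′)»), bookkeeping] -/
theorem QpsY_deltaY_eq_zero {s₁ : BlkY i} (F : 𝔸) {z : SiteY i} (hz : ¬ blkOf i.D.toDomains z = s₁) :
    QpsY i parS U (deltaY s₁ F) z = 0 := by
  rw [QpsY_deltaY_apply, if_neg hz]

/-- `‖Q′*_U(δ_{y₁} ⊗ F)(z)‖ ≤ 1` for `‖F‖ ≤ 1` and CONTRACTIVE transporters (`‖τ‖, ‖τ⁻¹‖ ≤ 1` — unitary matrices in print).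
[cite: Balaban1985BackgroundPropagators, (3.21) p.394 («U(Γ_{y,x})»), (3.42) p.397 («|λ|»), bookkeeping] -/
theorem norm_QpsY_deltaY_le (hpar : ∀ z w : SiteY i, ‖(parS U z w : 𝔸)‖ ≤ 1 ∧ ‖(((parS U z w)⁻¹ : 𝔸ˣ) : 𝔸)‖ ≤ 1)
    (s₁ : BlkY i) {F : 𝔸} (hF : ‖F‖ ≤ 1) (z : SiteY i) : ‖QpsY i parS U (deltaY s₁ F) z‖ ≤ 1 := by
  rw [QpsY_deltaY_apply]
  split_ifs
  · rw [R_def, inv_inv]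
    obtain ⟨h1, h2⟩ := hpar (Node00.blkCornerY i s₁) z
    calc ‖(((qpT i parS U s₁ z)⁻¹ : 𝔸ˣ) : 𝔸) * F * (qpT i parS U s₁ z : 𝔸)‖
        ≤ ‖(((qpT i parS U s₁ z)⁻¹ : 𝔸ˣ) : 𝔸)‖ * ‖F‖ * ‖(qpT i parS U s₁ z : 𝔸)‖ :=
          (norm_mul_le _ _).trans (mul_le_mul_of_nonneg_right (norm_mul_le _ _) (norm_nonneg _))
      _ ≤ 1 * 1 * 1 := by
          refine mul_le_mul (mul_le_mul h2 hF (norm_nonneg _) zero_le_one) h1 (norm_nonneg _) (by norm_num)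
      _ = 1 := by norm_num
  · rw [norm_zero]; exact zero_le_one

end TestFunction

/-! ## §2 ★★ `Left342At` FROM THE TWO SUP MAJORANTS OF THE COORDINATE MODELS (the first two conjuncts of `B9Thm37Whole.Conv342` at the site pins) -/

section Left

open Node00 (SiteY BlkY IBondY FBondY CfgY SiteOpY SiteParY toKT etaS deltaY QpsY cdS)
open B6Geom246MultiLevelBox (blkOf)
open B6GlobalChartV1 (blkV1)
open B6Ineq2142KLevelV1 (lvl β)
open B9Thm34Ext (toB6)
open B9CoReadingCoordsS (XSK blkSK sIK GcoS DcoS DcoS_comp_GcoS)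
open B9Ineq349SiteComposite (lenB distB lenB_pos etaS_pos Left342At cdSL cdSL_apply)
open B9GeoLemma21KLevelV1 (geo9Y_len_pos)
open B9PinMembersKLevelV1 (MemberY geo9Y)
open B9RWSumsReadsNbr (nbr)

variable {d ℓ : ℕ} {hd : 1 ≤ d + 1} {hL : Odd (ℓ + 1) ∧ 1 < ℓ + 1} {b₀ b₁ : ℝ} {Mstar : ℕ}
variable [CompleteSpace 𝔸] [FiniteDimensional ℝ 𝔸]

open Classical in
/-- ★★ **THE LEFT (3.42) SCHEMA OF (3.49) FROM THE BLOCK MAJORANTS OF THE COORDINATE MODELS** (print p. 410: *«Theorem 3.7 implies that all the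
inequalities (3.42)–(3.47) hold for G′»*, read at the test functions `λ = Q′*_U(δ_{y₁}⊗F)` of p. 399's (3.49) derivation): at a member `x`, a real basis
`b` of `𝔸`, a block map `bI` on fine bonds LEVEL-FAITHFUL (`hlev`) and 1-FAITHFUL (`hβ1`), the radius-2 count `#nbr ≤ mN`, CONTRACTIVE site transporters,
and the two sup majorants `|O(U)λ| ≤ C(Lʲη)²e^{−δd}|λ|`, `|∇_UO(U)λ| ≤ C·Lʲη·e^{−δd}|λ|` of the `η²`-∕`η`-scaled coordinate models `GcoS`, `DcoS ∘ GcoS`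
(block map `blkSK (sIK bI)` — the N06 knit's site pins; `C, δ ≥ 0`): `Left342At` holds for `O` at `U` with `B₀ = mN·C·e^{2δ}` and rate `δ`.
[cite: Balaban1985BackgroundPropagators, Thm 3.1 (3.42) p.397, (3.49) p.399, Thm 3.7 ⇒ Thm 3.1 p.410; Balaban1984PropagatorsII, (2.51)–(2.52) p.232] -/
theorem left342At_of_hasMajorants (x : MemberY d ℓ hd hL b₀ b₁ Mstar) [Fintype (geo9Y x).Site] (b : Module.Basis κ ℝ 𝔸)
    {B : B9.Backgrounds} (cfg : B.Cfg → CfgY 𝔸 x.toKIdx) (O : SiteOpY 𝔸 x.toKIdx) (parS : SiteParY 𝔸 x.toKIdx) (U₁ : B.Cfg)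
    {bI : FBondY x.toKIdx → IBondY x.toKIdx}
    (hlev : ∀ f : FBondY x.toKIdx, lvl x.hN x.D x.hk (bI f) = (blkV1 x.hN x.D f).1.1)
    (hβ1 : ∀ f : FBondY x.toKIdx, (B6Geom246MultiLevelTorus.geomT x.D).dist (β x.hN x.D x.hk (bI f)) (blkV1 x.hN x.D f) ≤ 1)
    {mN : ℕ} (hnbr : ∀ y : (geo9Y x).Site, (nbr (geo9Y x) 2 y).card ≤ mN)
    (hpar : ∀ z w : SiteY x.toKIdx, ‖(parS (cfg U₁) z w : 𝔸)‖ ≤ 1 ∧ ‖(((parS (cfg U₁) z w)⁻¹ : 𝔸ˣ) : 𝔸)‖ ≤ 1)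
    {R : ℝ} {H : Prop} {C δ : ℝ} (hC : 0 ≤ C) (hδ : 0 ≤ δ)
    (h0 : HasMajorant (g := toB6 (geo9Y x) R H) (blkSK x.toKIdx (sIK x.toKIdx bI)) (GcoS x.toKIdx b B cfg O U₁)
      (fun a a' => C * (geo9Y x).len a ^ 2 * Real.exp (-(δ * (geo9Y x).dist a a'))))
    (h1 : HasMajorantHom (g := toB6 (geo9Y x) R H) (blkSK x.toKIdx (sIK x.toKIdx bI)) (blkSK x.toKIdx (sIK x.toKIdx bI))
      (DcoS x.toKIdx b B cfg U₁ ∘ₗ GcoS x.toKIdx b B cfg O U₁) (fun a a' => C * (geo9Y x).len a * Real.exp (-(δ * (geo9Y x).dist a a')))) :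
    Left342At x.toKIdx parS O (cfg U₁) (mN * C * Real.exp (2 * δ)) δ := by
  intro s s₁ F hF z hz
  have hsupp : ∀ w : SiteY x.toKIdx, ¬ blkOf x.D.toDomains w = s₁ → QpsY x.toKIdx parS (cfg U₁) (deltaY s₁ F) w = 0 :=
    fun w hw => QpsY_deltaY_eq_zero x.toKIdx parS (cfg U₁) F hw
  have hbd : ∀ w : SiteY x.toKIdx, ‖QpsY x.toKIdx parS (cfg U₁) (deltaY s₁ F) w‖ ≤ 1 :=
    fun w => norm_QpsY_deltaY_le x.toKIdx parS (cfg U₁) hpar s₁ hF w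
  have hlen0 : ∀ a : (geo9Y x).Site, 0 ≤ (geo9Y x).len a := fun a => (geo9Y_len_pos x a).le
  -- the blocks met by `B(y₁)` under the block map
  set I : Finset (IBondY x.toKIdx) := (Finset.univ.filter fun w : SiteY x.toKIdx => blkOf x.D.toDomains w = s₁).image (sIK x.toKIdx bI) with hIdef
  have hI : ∀ w : SiteY x.toKIdx, blkOf x.D.toDomains w = s₁ → sIK x.toKIdx bI w ∈ I := fun w hw =>
    Finset.mem_image_of_mem _ (Finset.mem_filter.2 ⟨Finset.mem_univ _, hw⟩)
  refine ⟨?_, fun μ => ?_⟩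
  · -- entry `|O(U)λ|(x)`: the `η²`-scaled model `GcoS`, slice `(0, ·, c)`
    have hK : ∀ a a' : (geo9Y x).Site, 0 ≤ C * (geo9Y x).len a ^ 2 * Real.exp (-(δ * (geo9Y x).dist a a')) :=
      fun a a' => mul_nonneg (mul_nonneg hC (pow_nonneg (hlen0 a) 2)) (Real.exp_nonneg _)
    have h0' : HasMajorantHom (g := toB6 (geo9Y x) R H) (fun p : XSK κ x.toKIdx => sIK x.toKIdx bI p.1) (fun p : XSK κ x.toKIdx => sIK x.toKIdx bI p.1)
        ((etaS x.toKIdx ^ 2 * cR39 b) • coordOpK b (fun _ : Fin (d + 1) => (O (cfg U₁)).restrictScalars ℝ))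
        (fun a a' => C * (geo9Y x).len a ^ 2 * Real.exp (-(δ * (geo9Y x).dist a a'))) :=
      (hasMajorantHom_iff (g := toB6 (geo9Y x) R H) _ _ _).2 h0
    have step := mul_norm_apply_le_of_hasMajorantHom (g := toB6 (geo9Y x) R H) b (sIK x.toKIdx bI) (pow_nonneg (etaS_pos x.toKIdx).le 2) hK h0'
      (fun w : SiteY x.toKIdx => blkOf x.D.toDomains w = s₁) hsupp zero_le_one hbd I hI z (0 : Fin (d + 1))
    rw [one_mul] at step
    have hsum := sum_image_sIK_le x hlev hβ1 hnbr hC hδ (fun t : ℝ => t ^ 2) (s₁ := s₁) (pow_nonneg (lenB_pos x.toKIdx s).le 2) hz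
    have key := step.trans hsum
    calc etaS x.toKIdx ^ 2 * ‖O (cfg U₁) (QpsY x.toKIdx parS (cfg U₁) (deltaY s₁ F)) z‖
        ≤ mN * (C * lenB x.toKIdx s ^ 2 * Real.exp (2 * δ) * Real.exp (-(δ * distB x.toKIdx s s₁))) := key
      _ = mN * C * Real.exp (2 * δ) * lenB x.toKIdx s ^ 2 * Real.exp (-(δ * distB x.toKIdx s s₁)) := by ring
  · -- entry `|∇_{U,μ}O(U)λ|(x)`: the composite model `DcoS ∘ GcoS`, slice `(μ, ·, c)`
    have hK : ∀ a a' : (geo9Y x).Site, 0 ≤ C * (geo9Y x).len a * Real.exp (-(δ * (geo9Y x).dist a a')) :=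
      fun a a' => mul_nonneg (mul_nonneg hC (hlen0 a)) (Real.exp_nonneg _)
    have h1' : HasMajorantHom (g := toB6 (geo9Y x) R H) (fun p : XSK κ x.toKIdx => sIK x.toKIdx bI p.1) (fun p : XSK κ x.toKIdx => sIK x.toKIdx bI p.1)
        ((etaS x.toKIdx * cR39 b) • coordOpK b (fun ν => (cdSL x.toKIdx (cfg U₁) ν).restrictScalars ℝ ∘ₗ (O (cfg U₁)).restrictScalars ℝ))
        (fun a a' => C * (geo9Y x).len a * Real.exp (-(δ * (geo9Y x).dist a a'))) := by
      have h := h1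
      rw [DcoS_comp_GcoS] at h
      exact h
    have step := mul_norm_apply_le_of_hasMajorantHom (g := toB6 (geo9Y x) R H) b (sIK x.toKIdx bI) (etaS_pos x.toKIdx).le hK h1'
      (fun w : SiteY x.toKIdx => blkOf x.D.toDomains w = s₁) hsupp zero_le_one hbd I hI z μ
    rw [one_mul, LinearMap.comp_apply, LinearMap.restrictScalars_apply, LinearMap.restrictScalars_apply, cdSL_apply] at step
    have hsum := sum_image_sIK_le x hlev hβ1 hnbr hC hδ (fun t : ℝ => t) (s₁ := s₁) (lenB_pos x.toKIdx s).le hz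
    have key := step.trans hsum
    calc etaS x.toKIdx * ‖cdS x.toKIdx (cfg U₁) μ (O (cfg U₁) (QpsY x.toKIdx parS (cfg U₁) (deltaY s₁ F))) z‖
        ≤ mN * (C * lenB x.toKIdx s * Real.exp (2 * δ) * Real.exp (-(δ * distB x.toKIdx s s₁))) := key
      _ = mN * C * Real.exp (2 * δ) * lenB x.toKIdx s * Real.exp (-(δ * distB x.toKIdx s s₁)) := by ring

end Left

/-! ## §3 The family statements: `Thm31LeftSchema` from the Thm-3.7 majorants at the site pins; ROW 25 at def-Y's v4 record with `h31S` GONE -/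

section Family

open Node00
open B6Geom246MultiLevelBox (blkOf)
open B6GlobalChartV1 (blkV1)
open B6Ineq2142KLevelV1 (lvl β)
open B9Thm34Ext (toB6)
open B9Thm37Whole (Ops Conv342)
open B9RWSums343to347Whole (E37AllOfOps ConvAll342)
open B9CoReadingCoordsS (XSK blkSK sIK GcoS DcoS)
open B9Ineq349SiteReading (p349SiteY)
open B9Ineq349SiteComposite (lenB distB lenB_pos distB_nonneg etaS_pos Left342At)
open B9Ineq349SiteFromBlocks (Thm32BlkSchema)
open B9Ineq349SiteAdjoint (Thm31LeftSchema stmt349Printed_site_lettersYOfRecordV4_of_left)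
open B7Prop2SpecialUnitary (specialUnitaryUnits specialUnitaryUnits_le_unitaryUnits)
open B9PinMembersKLevelV1 (MemberY geo9Y bg9Y)
open B9RWSumsReadsNbr (nbr)

variable {d ℓ : ℕ} {hd : 1 ≤ d + 1} {hL : Odd (ℓ + 1) ∧ 1 < ℓ + 1} {b₀ b₁ : ℝ} {Mstar : ℕ}

omit [Fintype κ] [DecidableEq κ] in
/-- `Left342At` is monotone in the constant `B₀`. [cite: Balaban1985BackgroundPropagators, Thm 3.1 (3.42) p.397, bookkeeping] -/
theorem left342At_mono [CompleteSpace 𝔸] {i : B6KLevelCensusIndexV1.KIdx d ℓ hd hL b₀ b₁} {parS : SiteParY 𝔸 i} {O : SiteOpY 𝔸 i} {U : CfgY 𝔸 i}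
    {B₀ B₀' δ₀ : ℝ} (h : Left342At i parS O U B₀ δ₀) (hB : B₀ ≤ B₀') : Left342At i parS O U B₀' δ₀ := by
  intro s s₁ F hF z hz
  obtain ⟨h1, h2⟩ := h s s₁ F hF z hz
  have hl : 0 ≤ lenB i s := (lenB_pos i s).le
  refine ⟨h1.trans ?_, fun μ => (h2 μ).trans ?_⟩
  · exact mul_le_mul_of_nonneg_right (mul_le_mul_of_nonneg_right hB (pow_nonneg hl 2)) (Real.exp_nonneg _)
  · exact mul_le_mul_of_nonneg_right (mul_le_mul_of_nonneg_right hB hl) (Real.exp_nonneg _)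

omit [DecidableEq κ] in
/-- ★ **FROM THE LEAF OF THEOREM 3.7 TO THE TWO MAJORANTS AT THE SITE PINS**: if every member's expansion data `E x` converges in the sense containing
n06-c's `Conv342 (𝔬 x) (R x) (H x) C δ U` (e.g. `E37AllOfOps`, `E37YNbr`, `E37YPair`: first conjunct of `ConvAll342`), and the walk letters `𝔬 x` are
pinned to the coordinate models of the GENUINE letter `(𝔏 x).Gp` (`blk = blkY = blkSK (sIK bI)`, `Gp = GcoS`, `D = DcoS` — the N06 knit's site pins),
then `B9.Thm37Printed c35 geo9Y bg9Y E` delivers, under the printed prefix of Theorem 3.7, the sup majorants of `GcoS … (𝔏 x).Gp U` and of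
`DcoS U ∘ GcoS … (𝔏 x).Gp U`. [cite: Balaban1985BackgroundPropagators, Thm 3.7 p.409 + «Theorem 3.7 implies (3.42)–(3.47)» p.410] -/
theorem majorants_of_thm37Printed [CompleteSpace 𝔸] [FiniteDimensional ℝ 𝔸] {G : Subgroup 𝔸ˣ}
    [∀ x : MemberY d ℓ hd hL b₀ b₁ Mstar, Fintype (geo9Y x).Site] [∀ x : MemberY d ℓ hd hL b₀ b₁ Mstar, DecidableEq (geo9Y x).Site]
    (b : Module.Basis κ ℝ 𝔸) {c35 : ℝ} (𝔏 : ∀ x : MemberY d ℓ hd hL b₀ b₁ Mstar, CovLettersY 𝔸 x)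
    {ι : MemberY d ℓ hd hL b₀ b₁ Mstar → Type}
    (𝔬 : ∀ x : MemberY d ℓ hd hL b₀ b₁ Mstar, Ops (geo9Y x) (bg9Y 𝔸 G x) (XSK κ x.toKIdx) (XSK κ x.toKIdx) (ι x))
    (E : ∀ x : MemberY d ℓ hd hL b₀ b₁ Mstar, B9.RWExpansion (geo9Y x) (bg9Y 𝔸 G x))
    (t37 : B9.Thm37Printed c35 (fun x : MemberY d ℓ hd hL b₀ b₁ Mstar => geo9Y x) (fun x => bg9Y 𝔸 G x) E)
    {R : MemberY d ℓ hd hL b₀ b₁ Mstar → ℝ} {H : MemberY d ℓ hd hL b₀ b₁ Mstar → Prop} {C δ : ℝ} (hC : 0 ≤ C) (hδ : 0 < δ)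
    (hconv : ∀ (x : MemberY d ℓ hd hL b₀ b₁ Mstar) (U : (bg9Y 𝔸 G x).Cfg), (E x).Converges U → Conv342 (𝔬 x) (R x) (H x) C δ U)
    {bI : ∀ x : MemberY d ℓ hd hL b₀ b₁ Mstar, FBondY x.toKIdx → IBondY x.toKIdx}
    (hblkS : ∀ x : MemberY d ℓ hd hL b₀ b₁ Mstar, (𝔬 x).blk = blkSK x.toKIdx (sIK x.toKIdx (bI x)))
    (hblkYS : ∀ x : MemberY d ℓ hd hL b₀ b₁ Mstar, (𝔬 x).blkY = blkSK x.toKIdx (sIK x.toKIdx (bI x)))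
    (hGpS : ∀ (x : MemberY d ℓ hd hL b₀ b₁ Mstar) (U : (bg9Y 𝔸 G x).Cfg), (𝔬 x).Gp U = GcoS x.toKIdx b (bg9Y 𝔸 G x) (fun U => U) (𝔏 x).Gp U)
    (hDS : ∀ (x : MemberY d ℓ hd hL b₀ b₁ Mstar) (U : (bg9Y 𝔸 G x).Cfg), (𝔬 x).D U = DcoS x.toKIdx b (bg9Y 𝔸 G x) (fun U => U) U) :
    ∃ M₂ a₀ C δ : ℝ, 0 < M₂ ∧ 0 < a₀ ∧ 0 ≤ C ∧ 0 < δ ∧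
      ∀ x : MemberY d ℓ hd hL b₀ b₁ Mstar, M₂ ≤ (geo9Y x).M → ∀ α₀ : ℝ, 0 < α₀ → (geo9Y x).M * α₀ ≤ a₀ →
        ∀ U : (bg9Y 𝔸 G x).Cfg, (bg9Y 𝔸 G x).Reg335 c35 α₀ U →
          HasMajorant (g := toB6 (geo9Y x) (R x) (H x)) (blkSK x.toKIdx (sIK x.toKIdx (bI x)))
              (GcoS x.toKIdx b (bg9Y 𝔸 G x) (fun U => U) (𝔏 x).Gp U)
              (fun a a' => C * (geo9Y x).len a ^ 2 * Real.exp (-(δ * (geo9Y x).dist a a'))) ∧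
            HasMajorantHom (g := toB6 (geo9Y x) (R x) (H x)) (blkSK x.toKIdx (sIK x.toKIdx (bI x))) (blkSK x.toKIdx (sIK x.toKIdx (bI x)))
              (DcoS x.toKIdx b (bg9Y 𝔸 G x) (fun U => U) U ∘ₗ GcoS x.toKIdx b (bg9Y 𝔸 G x) (fun U => U) (𝔏 x).Gp U)
              (fun a a' => C * (geo9Y x).len a * Real.exp (-(δ * (geo9Y x).dist a a'))) := by
  obtain ⟨M₂, a₀, hM₂, ha₀, H37⟩ := t37
  refine ⟨M₂, a₀, C, δ, hM₂, ha₀, hC, hδ, fun x hM α₀ hα₀ hMa U hU => ?_⟩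
  obtain ⟨h0, h1, -, -⟩ := hconv x U (H37 x hM α₀ hα₀ hMa U hU)
  rw [hblkS x, hGpS x U] at h0
  rw [hblkS x, hblkYS x, hGpS x U, hDS x U] at h1
  exact ⟨h0, h1⟩

omit [Fintype κ] [DecidableEq κ] in
/-- the all-blocks expansion data of n06-k's faces converge INTO `Conv342` (first conjunct of `ConvAll342`; `E37YNbr`∕`E37YPair` are `E37AllOfOps` by `rfl`).
[cite: Balaban1985BackgroundPropagators, Thm 3.7 p.409, bookkeeping] -/
theorem conv342_of_converges_E37AllOfOps {g : B9.Geometry} [Fintype g.Site] [DecidableEq g.Site] {B : B9.Backgrounds} {X Y ι : Type}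
    (𝔴 : B9.RWExpansion g B) (𝔬 : Ops g B X Y ι) (R : ℝ) (H : Prop) (C δ : ℝ) (K : B9.KernelFamily g B) (B₀ δ₀ : ℝ) (Bβ Bε : ℝ → ℝ)
    (Bεβ : ℝ → ℝ → ℝ) (U : B.Cfg) (h : (E37AllOfOps 𝔴 𝔬 R H C δ K B₀ δ₀ Bβ Bε Bεβ).Converges U) : Conv342 𝔬 R H C δ U :=
  h.1

open scoped Matrix.Norms.L2Operator

variable {N : ℕ}

omit [Fintype κ] [DecidableEq κ] in
/-- an element of `U(N)` has operator norm `≤ 1`. [cite: Balaban1985Averaging, (19)–(20) p.21, bookkeeping] -/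
theorem norm_le_one_of_mem_unitaryUnits {u : (Matrix (Fin N) (Fin N) ℂ)ˣ} (hu : u ∈ B7Prop2Explicit.unitaryUnits (Matrix (Fin N) (Fin N) ℂ)) :
    ‖(u : Matrix (Fin N) (Fin N) ℂ)‖ ≤ 1 := by
  have hU : (u : Matrix (Fin N) (Fin N) ℂ) ∈ unitary (Matrix (Fin N) (Fin N) ℂ) := hu
  rcases subsingleton_or_nontrivial (Matrix (Fin N) (Fin N) ℂ) with h | h
  · rw [Subsingleton.elim (u : Matrix (Fin N) (Fin N) ℂ) 0, norm_zero]; exact zero_le_one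
  · exact (CStarRing.norm_of_mem_unitary hU).le

omit [Fintype κ] [DecidableEq κ] in
/-- transporters in a subgroup `G ≤ U(N)` are CONTRACTIVE together with their inverses. [cite: Balaban1985BackgroundPropagators, (3.21) p.394 + (3.35) p.396, bookkeeping] -/
theorem contractive_of_mem {G : Subgroup (Matrix (Fin N) (Fin N) ℂ)ˣ} (hG : G ≤ B7Prop2Explicit.unitaryUnits (Matrix (Fin N) (Fin N) ℂ))
    {u : (Matrix (Fin N) (Fin N) ℂ)ˣ} (hu : u ∈ G) :
    ‖(u : Matrix (Fin N) (Fin N) ℂ)‖ ≤ 1 ∧ ‖((u⁻¹ : (Matrix (Fin N) (Fin N) ℂ)ˣ) : Matrix (Fin N) (Fin N) ℂ)‖ ≤ 1 :=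
  ⟨norm_le_one_of_mem_unitaryUnits (hG hu), norm_le_one_of_mem_unitaryUnits (hG (G.inv_mem hu))⟩

/-- ★★ **`Thm31LeftSchema` FROM THE TWO SUP MAJORANTS AT THE SITE PINS** (`𝔸 = M_N(ℂ)`, `G ≤ U(N)`, transporters `G`-valued on (3.35) configurations):
under the printed prefix of Theorem 3.7 (`M ≥ M₂`, `0 < α₀`, `Mα₀ ≤ a₀`, `U` in (3.35)) the block majorants `C(Lʲη)²e^{−δd}` of `GcoS … (𝔏 x).Gp U` and
`C·Lʲη·e^{−δd}` of `DcoS ∘ GcoS` (faithful `bI`, count `mN`) give `Left342At` for every member with `B₀ = max(1, mN·C·e^{2δ})`, rate `δ`.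
[cite: Balaban1985BackgroundPropagators, Thm 3.1 (3.42) p.397 ⇐ Thm 3.7 p.410; (3.25) p.394, (3.35) p.396] -/
theorem thm31LeftSchema_of_majorants {G : Subgroup (Matrix (Fin N) (Fin N) ℂ)ˣ} (hG : G ≤ B7Prop2Explicit.unitaryUnits (Matrix (Fin N) (Fin N) ℂ))
    [∀ x : MemberY d ℓ hd hL b₀ b₁ Mstar, Fintype (geo9Y x).Site] (b : Module.Basis κ ℝ (Matrix (Fin N) (Fin N) ℂ)) {c35 : ℝ}
    (𝔏 : ∀ x : MemberY d ℓ hd hL b₀ b₁ Mstar, CovLettersY (Matrix (Fin N) (Fin N) ℂ) x)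
    (hparG : ∀ (x : MemberY d ℓ hd hL b₀ b₁ Mstar) (U : CfgY (Matrix (Fin N) (Fin N) ℂ) x.toKIdx), (∀ μ y, U μ y ∈ G) →
      ∀ z w : SiteY x.toKIdx, (𝔏 x).parS U z w ∈ G)
    {bI : ∀ x : MemberY d ℓ hd hL b₀ b₁ Mstar, FBondY x.toKIdx → IBondY x.toKIdx}
    (hlev : ∀ (x : MemberY d ℓ hd hL b₀ b₁ Mstar) (f : FBondY x.toKIdx), lvl x.hN x.D x.hk (bI x f) = (blkV1 x.hN x.D f).1.1)
    (hβ1 : ∀ (x : MemberY d ℓ hd hL b₀ b₁ Mstar) (f : FBondY x.toKIdx), (B6Geom246MultiLevelTorus.geomT x.D).dist (β x.hN x.D x.hk (bI x f)) (blkV1 x.hN x.D f) ≤ 1)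
    {mN : ℕ} (hnbr : ∀ (x : MemberY d ℓ hd hL b₀ b₁ Mstar) (y : (geo9Y x).Site), (nbr (geo9Y x) 2 y).card ≤ mN)
    {R : MemberY d ℓ hd hL b₀ b₁ Mstar → ℝ} {H : MemberY d ℓ hd hL b₀ b₁ Mstar → Prop}
    (h : ∃ M₂ a₀ C δ : ℝ, 0 < M₂ ∧ 0 < a₀ ∧ 0 ≤ C ∧ 0 < δ ∧
      ∀ x : MemberY d ℓ hd hL b₀ b₁ Mstar, M₂ ≤ (geo9Y x).M → ∀ α₀ : ℝ, 0 < α₀ → (geo9Y x).M * α₀ ≤ a₀ →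
        ∀ U : (bg9Y (Matrix (Fin N) (Fin N) ℂ) G x).Cfg, (bg9Y (Matrix (Fin N) (Fin N) ℂ) G x).Reg335 c35 α₀ U →
          HasMajorant (g := toB6 (geo9Y x) (R x) (H x)) (blkSK x.toKIdx (sIK x.toKIdx (bI x)))
              (GcoS x.toKIdx b (bg9Y (Matrix (Fin N) (Fin N) ℂ) G x) (fun U => U) (𝔏 x).Gp U)
              (fun a a' => C * (geo9Y x).len a ^ 2 * Real.exp (-(δ * (geo9Y x).dist a a'))) ∧
            HasMajorantHom (g := toB6 (geo9Y x) (R x) (H x)) (blkSK x.toKIdx (sIK x.toKIdx (bI x))) (blkSK x.toKIdx (sIK x.toKIdx (bI x)))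
              (DcoS x.toKIdx b (bg9Y (Matrix (Fin N) (Fin N) ℂ) G x) (fun U => U) U ∘ₗ
                GcoS x.toKIdx b (bg9Y (Matrix (Fin N) (Fin N) ℂ) G x) (fun U => U) (𝔏 x).Gp U)
              (fun a a' => C * (geo9Y x).len a * Real.exp (-(δ * (geo9Y x).dist a a')))) :
    Thm31LeftSchema (G := G) c35 𝔏 := by
  obtain ⟨M₂, a₀, C, δ, hM₂, ha₀, hC, hδ, hmaj⟩ := h
  refine ⟨M₂, δ, a₀, max 1 (mN * C * Real.exp (2 * δ)), hM₂, hδ, ha₀, lt_of_lt_of_le one_pos (le_max_left _ _),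
    fun x hM α₀ hα₀ hMa U hU => ?_⟩
  obtain ⟨h0, h1⟩ := hmaj x hM α₀ hα₀ hMa U hU
  have hUG : ∀ μ y, U μ y ∈ G := hU.1.1
  have hpar : ∀ z w : SiteY x.toKIdx, ‖((𝔏 x).parS U z w : Matrix (Fin N) (Fin N) ℂ)‖ ≤ 1 ∧
      ‖((((𝔏 x).parS U z w)⁻¹ : (Matrix (Fin N) (Fin N) ℂ)ˣ) : Matrix (Fin N) (Fin N) ℂ)‖ ≤ 1 :=
    fun z w => contractive_of_mem hG (hparG x U hUG z w)
  have hL := left342At_of_hasMajorants (κ := κ) x b (B := bg9Y (Matrix (Fin N) (Fin N) ℂ) G x) (fun U => U) (𝔏 x).Gp (𝔏 x).parS U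
    (hlev x) (hβ1 x) (hnbr x) hpar hC hδ.le h0 h1
  exact left342At_mono hL (le_max_right _ _)

/-- ★★★ **ROW 25 AT def-Y's v4 RECORD WITH THE Thm-3.1 INPUT DERIVED** (`h31S` GONE): (3.49) for the genuine `P = I − R(U)` from the two sup majorants
of the coordinate models of the genuine `G′(U)` under Theorem 3.7's prefix (what the N06 knit's row 18 proves at the site pins), the faithful block map
(`hlev`, `hβ1`), the radius-2 count `hnbr`, and the block-complete (3.48) input `h32B` ONLY — the symmetry of `G′(U)` and the adjoint side are theorems
(`B9Ineq349SiteAdjoint`), the (3.25)-in-kernels dictionary, Lemma 2.1 and the power counting are theorems (`B9Ineq349SiteComposite`∕`…FromBlocks`).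
[cite: Balaban1985BackgroundPropagators, (3.49) p.399 («using again Lemma 2.1»); Thm 3.1 (3.42) p.397 ⇐ Thm 3.7 p.410; Thm 3.2 (3.48) p.398; (3.25) p.394] -/
theorem stmt349Printed_site_lettersYOfRecordV4_of_majorants (θ : Stage3Params) (Mstar : ℕ) (𝔯 : ResY N θ Mstar)
    [∀ x : MemberY θ.d₆ θ.ℓ₆ θ.hd' θ.hL' θ.b₀ θ.b₁ Mstar, Fintype (geo9Y x).Site] (b : Module.Basis κ ℝ (Matrix (Fin N) (Fin N) ℂ)) {c35 : ℝ}
    {bI : ∀ x : MemberY θ.d₆ θ.ℓ₆ θ.hd' θ.hL' θ.b₀ θ.b₁ Mstar, FBondY x.toKIdx → IBondY x.toKIdx}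
    (hlev : ∀ (x : MemberY θ.d₆ θ.ℓ₆ θ.hd' θ.hL' θ.b₀ θ.b₁ Mstar) (f : FBondY x.toKIdx), lvl x.hN x.D x.hk (bI x f) = (blkV1 x.hN x.D f).1.1)
    (hβ1 : ∀ (x : MemberY θ.d₆ θ.ℓ₆ θ.hd' θ.hL' θ.b₀ θ.b₁ Mstar) (f : FBondY x.toKIdx),
      (B6Geom246MultiLevelTorus.geomT x.D).dist (β x.hN x.D x.hk (bI x f)) (blkV1 x.hN x.D f) ≤ 1)
    {mN : ℕ} (hnbr : ∀ (x : MemberY θ.d₆ θ.ℓ₆ θ.hd' θ.hL' θ.b₀ θ.b₁ Mstar) (y : (geo9Y x).Site), (nbr (geo9Y x) 2 y).card ≤ mN)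
    {R : MemberY θ.d₆ θ.ℓ₆ θ.hd' θ.hL' θ.b₀ θ.b₁ Mstar → ℝ} {H : MemberY θ.d₆ θ.ℓ₆ θ.hd' θ.hL' θ.b₀ θ.b₁ Mstar → Prop}
    (h : ∃ M₂ a₀ C δ : ℝ, 0 < M₂ ∧ 0 < a₀ ∧ 0 ≤ C ∧ 0 < δ ∧
      ∀ x : MemberY θ.d₆ θ.ℓ₆ θ.hd' θ.hL' θ.b₀ θ.b₁ Mstar, M₂ ≤ (geo9Y x).M → ∀ α₀ : ℝ, 0 < α₀ → (geo9Y x).M * α₀ ≤ a₀ →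
        ∀ U : (bg9Y (Matrix (Fin N) (Fin N) ℂ) (specialUnitaryUnits (Fin N)) x).Cfg,
          (bg9Y (Matrix (Fin N) (Fin N) ℂ) (specialUnitaryUnits (Fin N)) x).Reg335 c35 α₀ U →
          HasMajorant (g := toB6 (geo9Y x) (R x) (H x)) (blkSK x.toKIdx (sIK x.toKIdx (bI x)))
              (GcoS x.toKIdx b (bg9Y (Matrix (Fin N) (Fin N) ℂ) (specialUnitaryUnits (Fin N)) x) (fun U => U) (lettersYOfRecordV4 N θ Mstar 𝔯 x).Gp U)
              (fun a a' => C * (geo9Y x).len a ^ 2 * Real.exp (-(δ * (geo9Y x).dist a a'))) ∧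
            HasMajorantHom (g := toB6 (geo9Y x) (R x) (H x)) (blkSK x.toKIdx (sIK x.toKIdx (bI x))) (blkSK x.toKIdx (sIK x.toKIdx (bI x)))
              (DcoS x.toKIdx b (bg9Y (Matrix (Fin N) (Fin N) ℂ) (specialUnitaryUnits (Fin N)) x) (fun U => U) U ∘ₗ
                GcoS x.toKIdx b (bg9Y (Matrix (Fin N) (Fin N) ℂ) (specialUnitaryUnits (Fin N)) x) (fun U => U) (lettersYOfRecordV4 N θ Mstar 𝔯 x).Gp U)
              (fun a a' => C * (geo9Y x).len a * Real.exp (-(δ * (geo9Y x).dist a a'))))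
    (h32 : Thm32BlkSchema (Matrix (Fin N) (Fin N) ℂ) (specialUnitaryUnits (Fin N)) c35 (lettersYOfRecordV4 N θ Mstar 𝔯)) :
    B9.Stmt349Printed (θ.d₆ + 1) c35 (geo9Y (d := θ.d₆) (ℓ := θ.ℓ₆) (hd := θ.hd') (hL := θ.hL') (b₀ := θ.b₀) (b₁ := θ.b₁) (Mstar := Mstar))
      (bg9Y (Matrix (Fin N) (Fin N) ℂ) (specialUnitaryUnits (Fin N))) (fun x => p349SiteY (Matrix (Fin N) (Fin N) ℂ) (specialUnitaryUnits (Fin N)) x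
        (lettersYOfRecordV4 N θ Mstar 𝔯 x)) :=
  stmt349Printed_site_lettersYOfRecordV4_of_left θ Mstar 𝔯
    (thm31LeftSchema_of_majorants specialUnitaryUnits_le_unitaryUnits b (lettersYOfRecordV4 N θ Mstar 𝔯)
      (fun x _ hUG z w => parSymY_mem x.toKIdx hUG z w) hlev hβ1 hnbr h) h32

end Family

end Literature.MathematicalPhysics.QuantumFieldTheory.Balaban1983to89.B9Ineq349SiteFromConv342

end
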